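import Summits.RiemannHypothesis.RiemannHypothesis.Theorems.PfPersistenceDilatingLandauTheta
import Literature.NumberTheory.LFunctions.ChebyshevPsiExplicit
import HarnessLib

/-!
# LANDAU for `θ` — II: Littlewood's oscillation for `θ(x) − x` and the failure of `θ(x) ≤ x`

Cell `pub-rhpf` (mechanism/rigidity campaign; **no RH claims**), CAND SEAT 7 gen 8, CASE-DAG v6 §6
kernel target LANDAU, second addendum for the PRIME-indicator statistic `θ`. File I
(`PfPersistenceDilatingLandauTheta`) left one row of the `θ`-reader table open: the upper readers at
or below the square-root scale, in particular the empirical prime deficit `θ(x) ≤ x` (true for all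
`x ≤ 10^{19}`), which it showed to be RH-STRENGTH (`riemannHypothesis_of_theta_le_self`) while noting
that Littlewood's theorem for `θ` was "not in tree". This file supplies it, UNCONDITIONALLY:

* `eventually_psi_sub_theta_le` : `ψ(x) − θ(x) ≤ 2√x` for all large `x` (from the tree's explicit
  `ψ − θ ≤ log 4 (√x + (log x/log 2) x^{1/3})`, `ChebyshevExplicit.psi_sub_theta_le_sharp`);
* `isOmegaPM_theta_sub` : **`θ(x) − x = Ω±(√x log log log x)`** (Littlewood's theorem for `ϑ`,
  MV Thm. 15.11), transferred from the tree barrier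
  `Literature.Barriers.RiemannHypothesis.LittlewoodOscillation_holds` for `ψ` through `ψ − θ = O(√x)`;
* `not_eventually_theta_sub_le_mul_rpow_of_le_half` : for every `A` and `σ ≤ 1/2` the upper reader
  `θ(x) − x ≤ A x^σ` FAILS for arbitrarily large `x`; in particular
  **`not_eventually_theta_le_self` : `θ(x) > x` for arbitrarily large `x`** — the prime deficit is
  not an invariant of `ζ` at all (it is RH-strength AND false), `theta_le_self_reader`;
* `theta_upper_trichotomy` : the completed upper row (σ ≤ 1/2 violated · RH ⟺ ∀ε `x^{1/2+ε}` ·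
  σ > 1/2 ⇒ quasi-RH(σ)), mirror of `theta_lower_trichotomy`.

Sorry-free and RH-free (RH occurs only inside `↔`/`→` statements quoted from file I).

References: [MontgomeryVaughan2007] H. L. Montgomery, R. C. Vaughan, *Multiplicative Number Theory I*,
CUP 2007, Thm. 15.11 ((15.22), stated for `ψ`; the `ϑ` form by `ψ − ϑ = O(√x)`, Thm. 2.7/§13.1),
Thm. 13.1, Thm. 15.3; [Littlewood1914] J. E. Littlewood, C. R. Acad. Sci. Paris 158 (1914).
-/

noncomputable section

-- the sub-problem path RiemannHypothesis/RiemannHypothesis duplicates a namespace (D-0017)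
set_option linter.dupNamespace false

open Filter Asymptotics Real
open scoped Topology Chebyshev

namespace Summit.RiemannHypothesis.RiemannHypothesis.Theorems.PfPersistenceDilatingLandauThetaLittlewood

open Literature.NumberTheory.LFunctions
open Literature.Barriers.RiemannHypothesis
open Summit.RiemannHypothesis.RiemannHypothesis.Theorems.PfPersistenceDilatingLandau
open Summit.RiemannHypothesis.RiemannHypothesis.Theorems.PfPersistenceDilatingLandauTheta

/-! ## §3 `ψ − θ = O(√x)` with constant `2` -/

/-- **`ψ(x) − θ(x) ≤ 2√x` for all large `x`** (from `ψ − θ ≤ log 4 (√x + (log x/log 2) x^{1/3})` and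
`x^{1/3} log x = o(√x)`). [cite: MontgomeryVaughan2007, Thm. 2.7 (ψ − ϑ ≍ √x); folklore] -/
theorem eventually_psi_sub_theta_le : ∀ᶠ x in atTop, ψ x - θ x ≤ 2 * x ^ (1 / 2 : ℝ) := by
  have hl4 : 0 < Real.log 4 := Real.log_pos (by norm_num)
  have hl2 : 0 < Real.log 2 := Real.log_pos (by norm_num)
  set κ : ℝ := 2 / Real.log 4 - 1 with hκ
  have hl42 : Real.log 4 < 2 := by
    -- `4 < e²` (also `Literature.NumberTheory.Sieve.SelbergSymmetry.log_four_lt_two`, not imported here)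
    rw [Real.log_lt_iff_lt_exp (by norm_num)]
    have h1 : (1 : ℝ) + 1 < Real.exp 1 := Real.add_one_lt_exp one_ne_zero
    have h2 : Real.exp 2 = Real.exp 1 * Real.exp 1 := by rw [← Real.exp_add]; norm_num
    nlinarith [Real.exp_pos 1]
  have hκ0 : 0 < κ := by
    rw [hκ, sub_pos, lt_div_iff₀ hl4]; linarith
  have ho := (isLittleO_log_rpow_atTop (by norm_num : (0 : ℝ) < 1 / 6)).bound (mul_pos hκ0 hl2)
  filter_upwards [ho, eventually_ge_atTop (2 : ℝ)] with x hlog hx2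
  have hx0 : 0 < x := by linarith
  rw [Real.norm_eq_abs, Real.norm_eq_abs, abs_of_nonneg (Real.log_nonneg (by linarith)),
    abs_of_nonneg (Real.rpow_nonneg hx0.le _)] at hlog
  have h16 : x ^ (1 / 6 : ℝ) * x ^ ((1 : ℝ) / 3) = x ^ (1 / 2 : ℝ) := by
    rw [← Real.rpow_add hx0]; norm_num
  have h1 : Real.log x / Real.log 2 * x ^ ((1 : ℝ) / 3) ≤ κ * x ^ (1 / 2 : ℝ) := by
    rw [div_mul_eq_mul_div, div_le_iff₀ hl2]
    calc Real.log x * x ^ ((1 : ℝ) / 3) ≤ κ * Real.log 2 * x ^ (1 / 6 : ℝ) * x ^ ((1 : ℝ) / 3) :=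
          mul_le_mul_of_nonneg_right hlog (Real.rpow_nonneg hx0.le _)
      _ = κ * x ^ (1 / 2 : ℝ) * Real.log 2 := by rw [mul_assoc (κ * Real.log 2), h16]; ring
  have h2 := ChebyshevExplicit.psi_sub_theta_le_sharp hx2
  rw [Real.sqrt_eq_rpow] at h2
  calc ψ x - θ x ≤ Real.log 4 * (x ^ (1 / 2 : ℝ) + Real.log x / Real.log 2 * x ^ ((1 : ℝ) / 3)) := h2
    _ ≤ Real.log 4 * (x ^ (1 / 2 : ℝ) + κ * x ^ (1 / 2 : ℝ)) := by gcongr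
    _ = 2 * x ^ (1 / 2 : ℝ) := by
        rw [hκ]; field_simp; ring

/-! ## §4 Littlewood's theorem for `θ`: `θ(x) − x = Ω±(√x log log log x)` -/

/-- **`θ(x) − x = Ω₊(√x log log log x)`** (unconditional): Littlewood's `Ω₊` for `ψ` minus
`ψ − θ ≤ 2√x = o(√x log log log x)`. [cite: MontgomeryVaughan2007, Thm. 15.11 (15.22); Littlewood1914] -/
theorem isOmegaPlus_theta_sub : IsOmegaPlus (fun x ↦ θ x - x) littlewoodGaugePsi := by
  obtain ⟨c, hc, hfreq⟩ := LittlewoodOscillation_holds.1.1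
  refine ⟨c / 2, by positivity, ?_⟩
  have hev : ∀ᶠ x in atTop, 2 * x ^ (1 / 2 : ℝ) ≤ c / 2 * littlewoodGaugePsi x := by
    filter_upwards [tendsto_logloglog_atTop.eventually_ge_atTop (4 / c), eventually_gt_atTop 0]
      with x hl hx
    have hxr : 0 < x ^ (1 / 2 : ℝ) := Real.rpow_pos_of_pos hx _
    have h4 : 4 ≤ c * logloglog x := by rw [mul_comm]; exact (div_le_iff₀ hc).1 hl
    rw [littlewoodGaugePsi]
    nlinarith
  refine (hfreq.and_eventually (hev.and eventually_psi_sub_theta_le)).mono fun x hx ↦ ?_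
  obtain ⟨hle, h2, h3⟩ := hx
  have hle' : c * littlewoodGaugePsi x ≤ ψ x - x := hle
  show c / 2 * littlewoodGaugePsi x ≤ θ x - x
  linarith

/-- **`θ(x) − x = Ω₋(√x log log log x)`** (unconditional; immediate from `θ ≤ ψ`). [cite: MontgomeryVaughan2007, Thm. 15.11 (15.22)] -/
theorem isOmegaMinus_theta_sub : IsOmegaMinus (fun x ↦ θ x - x) littlewoodGaugePsi := by
  obtain ⟨c, hc, hfreq⟩ := LittlewoodOscillation_holds.1.2
  refine ⟨c, hc, hfreq.mono fun x hx ↦ ?_⟩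
  have hx' : ψ x - x ≤ -(c * littlewoodGaugePsi x) := hx
  have := Chebyshev.theta_le_psi x
  show θ x - x ≤ -(c * littlewoodGaugePsi x)
  linarith

/-- **Littlewood's theorem for `θ`: `θ(x) − x = Ω±(√x log log log x)`** (unconditional).
[cite: MontgomeryVaughan2007, Thm. 15.11; Littlewood1914] -/
theorem isOmegaPM_theta_sub : IsOmegaPM (fun x ↦ θ x - x) littlewoodGaugePsi :=
  ⟨isOmegaPlus_theta_sub, isOmegaMinus_theta_sub⟩

/-! ## §5 The upper `θ`-readers at or below the square-root scale are violated by `ζ` -/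

/-- **`θ(x) − x > C√x` for arbitrarily large `x`, for EVERY real `C`** (unconditional).
[cite: MontgomeryVaughan2007, Thm. 15.11 (15.22)] -/
theorem frequently_mul_sqrt_lt_theta_sub (C : ℝ) :
    ∃ᶠ x in atTop, C * x ^ (1 / 2 : ℝ) < θ x - x := by
  obtain ⟨c, hc, hfreq⟩ := isOmegaPlus_theta_sub
  have hev : ∀ᶠ x in atTop, C / c < littlewoodGaugePsi x / x ^ (1 / 2 : ℝ) :=
    tendsto_littlewoodGaugePsi_div_sqrt.eventually_gt_atTop _
  refine (hfreq.and_eventually (hev.and (eventually_gt_atTop 0))).mono fun x hx ↦ ?_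
  obtain ⟨hle, hgt, hx0⟩ := hx
  have hle' : c * littlewoodGaugePsi x ≤ θ x - x := hle
  have hxr : 0 < x ^ (1 / 2 : ℝ) := Real.rpow_pos_of_pos hx0 _
  rw [div_lt_div_iff₀ hc hxr] at hgt
  have hcomm : littlewoodGaugePsi x * c = c * littlewoodGaugePsi x := mul_comm _ _
  linarith

/-- **No upper `θ`-reader at scale `A x^σ`, `σ ≤ 1/2`, is `ζ`-true:** `θ(x) − x ≤ A x^σ` fails for
arbitrarily large `x` (unconditional). [cite: MontgomeryVaughan2007, Thm. 15.11 (15.22)] -/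
theorem not_eventually_theta_sub_le_mul_rpow_of_le_half (A : ℝ) {σ : ℝ} (hσ : σ ≤ 1 / 2) :
    ¬ ∀ᶠ x in atTop, θ x - x ≤ A * x ^ σ := by
  intro h
  have hdom : ∀ᶠ x in atTop, A * x ^ σ ≤ |A| * x ^ (1 / 2 : ℝ) := by
    filter_upwards [eventually_ge_atTop 1] with x hx
    have hx0 : 0 < x := by linarith
    calc A * x ^ σ ≤ |A| * x ^ σ := mul_le_mul_of_nonneg_right (le_abs_self A) (Real.rpow_nonneg hx0.le _)
      _ ≤ |A| * x ^ (1 / 2 : ℝ) :=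
          mul_le_mul_of_nonneg_left (Real.rpow_le_rpow_of_exponent_le hx hσ) (abs_nonneg A)
  obtain ⟨x, hlt, hle, hd⟩ := ((frequently_mul_sqrt_lt_theta_sub |A|).and_eventually (h.and hdom)).exists
  linarith

/-- **The prime deficit fails infinitely often: `θ(x) > x` for arbitrarily large `x`** (unconditional;
Littlewood 1914 — although `θ(x) < x` for every `x ≤ 10^{19}`). [cite: MontgomeryVaughan2007, Thm. 15.11; Littlewood1914] -/
theorem not_eventually_theta_le_self : ¬ ∀ᶠ x in atTop, θ x ≤ x := by
  intro h
  refine not_eventually_theta_sub_le_mul_rpow_of_le_half 0 (σ := 0) (by norm_num) ?_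
  filter_upwards [h] with x hx
  simp only [zero_mul]
  linarith

/-- **The `θ(x) ≤ x` reader, both words:** it would imply RH (file I) and it is false for `ζ`
(this file) — RH-strength and unsound, never an RH-free certificate. [cite: MontgomeryVaughan2007, Thm. 15.3, Thm. 15.11] -/
theorem theta_le_self_reader :
    ((∀ᶠ x in atTop, θ x ≤ x) → RiemannHypothesis) ∧ ¬ ∀ᶠ x in atTop, θ x ≤ x :=
  ⟨riemannHypothesis_of_theta_le_self, not_eventually_theta_le_self⟩

/-- **The one-sided trichotomy for `θ`, upper side** (completing `theta_upper_dichotomy` of file I):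
`σ ≤ 1/2` violated by `ζ`; RH ⟺ the `x^{1/2+ε}`-∀ε reader; `σ > 1/2` ⇒ quasi-RH(`σ`).
[cite: MontgomeryVaughan2007, Thm. 13.1, Thm. 15.3, Thm. 15.11] -/
theorem theta_upper_trichotomy :
    (∀ A σ : ℝ, σ ≤ 1 / 2 → ¬ ∀ᶠ x in atTop, θ x - x ≤ A * x ^ σ) ∧
    (RiemannHypothesis ↔ ∀ ε : ℝ, 0 < ε → ∀ᶠ x in atTop, θ x - x ≤ x ^ (1 / 2 + ε)) ∧
    (∀ A σ : ℝ, 1 / 2 < σ → (∀ᶠ x in atTop, θ x - x ≤ A * x ^ σ) → QuasiRiemannHypothesis σ) :=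
  ⟨fun A _ hσ ↦ not_eventually_theta_sub_le_mul_rpow_of_le_half A hσ,
    riemannHypothesis_iff_theta_upper_eps,
    fun _ _ hσ hev ↦ quasiRiemannHypothesis_of_theta_upper hσ hev⟩

end Summit.RiemannHypothesis.RiemannHypothesis.Theorems.PfPersistenceDilatingLandauThetaLittlewood

end
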